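/-
Copyright (c) 2026 the pub-hodgecm-mathlib formalisation cell (harness21).  Prover seat hodgecm-mathlib-F0P3a-p07 (g11): road «S3-tree» (LEAD F0P3a-plan (g11), architect
A-p16 (g29) rulings A-73 (2) ∕ A-78 «S-a3-ram: the tamely ramified twin of S-a3»), brick S-a3-ram, FILE 2 of 2 «THE RAMIFIED UNIPOTENT FIXED-NEIGHBOUR LEMMA»; 2026-09-01.
-/
import Literature.NumberTheory.Automorphic.UnitaryLatticeTreeResiduallyUnipotentCorner  -- ★ S-a3 FILE 1 (this seat): `v_pow_sub_one_apply_lt_one`, `v_apply_mul_le_of_mapGL_latt_diagonal_le`, `residual_corner_*`, `residue_eq_zero_iff_v_lt_one`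
import Literature.NumberTheory.Automorphic.UnitaryLatticeTreeFixedCostarCoordsRamified   -- S-a3-ram FILE 1 (this seat): `mapGL_dual_N₁_eq_of_v`, `mapGL_N₁_sup_span_vec_eq_iff_of_v`, `isSelfDualLattice_N₁_sup_span_vec_of_neg`; brings ★ `vec_mem_N₁_iff`
import HarnessLib

/-!
# The lattice graph of a hermitian space — S-a3-ram FILE 2: AT A TAMELY RAMIFIED PLACE A RESIDUALLY UNIPOTENT ELEMENT OF A TYPE-TWO VERTEX STABILISER FIXES A SELF-DUAL NEIGHBOUR
# (Bruhat–Tits 1972 §10; Tits 1979 §3.5; Serre 1980 I.6.1 ∕ II.1.1; Jacobowitz 1962 §7–§8)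

Topic `NumberTheory/Automorphic`; namespace `Literature.NumberTheory.Automorphic.UnitaryLatticeTree`.  THEOREMS ONLY (no definition, no instance, no notation, no named fact,
no `sorry`); kernel lane.  Cell `pub/hodgecm-mathlib` (D-0151), crux H413 = `stmt-HodgeConjecture-24833`; road «S3-tree», brick **S-a3-ram** (architect A-73 (2) ∕ A-78; census
«S-a3-ram» v0, F0P3a-p07 (g11)) = the TAMELY RAMIFIED twin of ★ S-a3 `UnitaryLatticeTreeTypeTwoUnipotentFixedNeighbour`: the local input of «SPAN-0» at the places `w` of the
CM field RAMIFIED over the totally real field (odd residue characteristic), where `σϖ = −ϖ` for a suitable uniformiser and `σ` acts trivially on the residue field.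
THE MATHEMATICS (`K` with `Valued K ℤᵐ⁰`, uniformiser `ϖ`; `σ` valuation-preserving, `σϖ = −ϖ`, `|σx − x| < 1` on `𝒪`; `J₀ = antidiag(1,1,1)`, `U = U(σ, J₀)`;
`N₁ = latt diag(1,1,ϖ)` the standard type-two vertex, `N₁^♯ = latt diag(ϖ⁻¹,1,1)`).  Let `γ ∈ U` fix `N₁` with `charpoly γ ≡ (X − 1)³ mod 𝔪`.  Exactly as in S-a3 (same ★ FILE 1
algebra): the column tests on `N₁` and `N₁^♯` (FILE 1 `mapGL_dual_N₁_eq_of_v` — valid for any valuation-preserving `σ`) make `A = diag(1,1,ϖ⁻¹)·γ·diag(1,1,ϖ)` integral with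
`γ₁₀, ϖγ₁₂ ∈ 𝔪`, `(Ā − 1)³ = 0` (★ `v_pow_sub_one_apply_lt_one`), and the residual corner `R̄ = [[γ̄₀₀, ϖγ₀₂‾],[ϖ⁻¹γ₂₀‾, γ̄₂₂]]` is unipotent (★ `residual_corner_trace_det` ∕
★ `residual_corner_eq_one_of_lower_zero`).  Hence `R̄` fixes the point `[1:0]` (if `ϖ⁻¹γ₂₀ ∈ 𝔪`) or `[γ₀₀ − 1 : ϖ⁻¹γ₂₀]` (else) of `ℙ¹(𝓀)`, i.e. (FILE 1's `σϖ`-free fixed-point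
test `mapGL_N₁_sup_span_vec_eq_iff_of_v`) `γ` fixes the neighbour `M = N₁ + 𝒪·w(a,b)` through it — and AT A RAMIFIED PLACE EVERY PRIMITIVE NEIGHBOUR IS SELF-DUAL (FILE 1
`isSelfDualLattice_N₁_sup_span_vec_of_neg`: the residual plane is alternating), so no isotropy step is needed (contrast S-a3, where the transvection-line lemma was).  The head
(§2) transports from `N₁` to any type-two vertex by `htr₂` («`U` transitive on type-two vertices», a hypothesis here exactly as in ★ S-a3).
HONEST LABEL: HC_CM is proved only modulo the 2 remaining named inputs (hLiu418 24832, h413 24833) until rung 0 closes; nothing printed is asserted here (elementary lattice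
algebra over a valuation ring); S3 (`stub_N6nsS3id`) stays a print row until the road's END lands; `htr₂` at ramified `w` is booked END-side («htr₂-ram»).

* §1 **`exists_isSelfDualLattice_gt_N₁_mapGL_eq_of_neg`** — S-a3-ram at `N₁`.
* §2 **`exists_isSelfDualLattice_gt_mapGL_eq_of_charpoly_of_neg`** — the head at any type-two vertex (modulo `htr₂`).

## References
* [BruhatTits1972] F. Bruhat, J. Tits, *Groupes réductifs sur un corps local I*, Publ. Math. IHÉS 41 (1972), §10 (lattice models; the star of a vertex = the residual building).
* [Tits1979] J. Tits, *Reductive groups over local fields*, PSPM 33.1 (1979), §3.5 (reduction mod `𝔭`), §3.11 (the ramified `SU₃`).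
* [Serre1980Trees] J.-P. Serre, *Trees* (1980), Ch. I §6.1 (fixed points), Ch. II §1.1 (neighbours of a lattice = lines of its reduction).
* [Jacobowitz1962] R. Jacobowitz, *Hermitian forms over local fields*, Amer. J. Math. 84 (1962), §7–§8 (unimodular ∕ modular hermitian lattices, ramified case).
-/

set_option autoImplicit false

noncomputable section

open scoped Valued WithZero Matrix MatrixGroups

namespace Literature.NumberTheory.Automorphic.UnitaryLatticeTree

open Literature.NumberTheory.Automorphic Literature.NumberTheory.Automorphic.HermitianLattice

variable {K : Type*} [Field K] [Valued K ℤᵐ⁰]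

section Ramified

open Literature.NumberTheory.Automorphic.CartanUnique

variable {σ : K →+* K} {ϖ : K}

/-! ## §1 S-a3-ram at the standard type-two vertex `N₁` -/

set_option maxHeartbeats 1600000 in
/-- **S-a3-ram AT `N₁`** (tamely ramified place: `σ` valuation-preserving, `σϖ = −ϖ`, `σ` trivial on the residue field).  Let `γ ∈ U(σ, J₀)` fix `N₁ = latt diag(1,1,ϖ)` and have
`charpoly γ ≡ charpoly 1 mod 𝔪` coefficientwise.  Then `γ` fixes a SELF-DUAL vertex `M` with `N₁ < M`: in the coordinates `w(a,b) = (a∕ϖ, 0, b)` of `N₁^♯∕N₁`,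
`M = N₁ + 𝒪·w(1, 0)` if `ϖ⁻¹γ₂₀ ∈ 𝔪` (the residual corner is then `1`, ★ `residual_corner_eq_one_of_lower_zero`), and `M = N₁ + 𝒪·w(γ₀₀ − 1, ϖ⁻¹γ₂₀)` otherwise (the image
of `R̄ − 1`, ★ `residual_corner_trace_det`); EVERY such neighbour is self-dual at a ramified place (FILE 1 `isSelfDualLattice_N₁_sup_span_vec_of_neg`), so — unlike S-a3 — no
isotropy step is needed. [cite: BruhatTits1972, §10] [cite: Tits1979, §3.5] [cite: Serre1980Trees, I.6.1 and II.1.1] [cite: Jacobowitz1962, §7–§8] -/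
theorem exists_isSelfDualLattice_gt_N₁_mapGL_eq_of_neg (hvσ : ∀ a, Valued.v (σ a) = Valued.v a) (hσϖ : σ ϖ = -ϖ)
    (hϖ : Valued.v ϖ = WithZero.exp (-1 : ℤ)) (hres : ∀ x : K, Valued.v x ≤ 1 → Valued.v (σ x - x) < 1)
    (γ : unitaryGroupOfForm σ ((StdForm.antidiagonal 3).over K))
    (hγ : mapGL (γ : GL (Fin 3) K) (latt (Matrix.diagonal ![(1 : K), 1, ϖ])) = latt (Matrix.diagonal ![(1 : K), 1, ϖ]))
    (hγ1 : ∀ i, Valued.v (((γ : GL (Fin 3) K) : Matrix (Fin 3) (Fin 3) K).charpoly.coeff i - (1 : Matrix (Fin 3) (Fin 3) K).charpoly.coeff i) < 1) :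
    ∃ M : Submodule 𝒪[K] (Fin 3 → K), IsSelfDualLattice σ ϖ ((StdForm.antidiagonal 3).over K) M ∧
      latt (Matrix.diagonal ![(1 : K), 1, ϖ]) < M ∧ mapGL (γ : GL (Fin 3) K) M = M := by
  have hϖ0 : ϖ ≠ 0 := uniformizer_ne_zero hϖ
  have hvϖ0 : Valued.v ϖ ≠ 0 := (Valuation.ne_zero_iff _).2 hϖ0
  have hlt : ∀ z : K, Valued.v z < 1 ↔ Valued.v z ≤ Valued.v ϖ := fun z => by rw [hϖ]; exact v_lt_one_iff z
  have hvinv : Valued.v ϖ⁻¹ * Valued.v ϖ = 1 := by rw [← map_mul, inv_mul_cancel₀ hϖ0, map_one]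
  set g : Matrix (Fin 3) (Fin 3) K := ((γ : GL (Fin 3) K) : Matrix (Fin 3) (Fin 3) K) with hgdef
  -- §A the column tests on `N₁` and on `N₁^♯ = latt diag(ϖ⁻¹,1,1)` (FILE 1: `Stab(N₁)` fixes `N₁^♯` for any valuation-preserving `σ`)
  have hdd : ∀ i, (![(1 : K), 1, ϖ] : Fin 3 → K) i ≠ 0 := by intro i; fin_cases i <;> simp [hϖ0]
  have hdd' : ∀ i, (![ϖ⁻¹, (1 : K), 1] : Fin 3 → K) i ≠ 0 := by intro i; fin_cases i <;> simp [hϖ0]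
  have hN := v_apply_mul_le_of_mapGL_latt_diagonal_le hdd (g := (γ : GL (Fin 3) K)) hγ.le
  have hD := v_apply_mul_le_of_mapGL_latt_diagonal_le hdd' (g := (γ : GL (Fin 3) K)) (mapGL_dual_N₁_eq_of_v hvσ hϖ γ hγ).le
  have e0 : (![(1 : K), 1, ϖ] : Fin 3 → K) 0 = 1 := rfl
  have e1 : (![(1 : K), 1, ϖ] : Fin 3 → K) 1 = 1 := rfl
  have e2 : (![(1 : K), 1, ϖ] : Fin 3 → K) 2 = ϖ := rfl
  have f0 : (![ϖ⁻¹, (1 : K), 1] : Fin 3 → K) 0 = ϖ⁻¹ := rfl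
  have f1 : (![ϖ⁻¹, (1 : K), 1] : Fin 3 → K) 1 = 1 := rfl
  have f2 : (![ϖ⁻¹, (1 : K), 1] : Fin 3 → K) 2 = 1 := rfl
  have h00 : Valued.v (g 0 0) ≤ 1 := by have h := hN 0 0; rw [e0, mul_one, map_one] at h; exact h
  have h01 : Valued.v (g 0 1) ≤ 1 := by have h := hN 0 1; rw [e0, e1, mul_one, map_one] at h; exact h
  have h02 : Valued.v (ϖ * g 0 2) ≤ 1 := by have h := hN 0 2; rw [e0, e2, mul_comm, map_one] at h; exact h
  have h11 : Valued.v (g 1 1) ≤ 1 := by have h := hN 1 1; rw [e1, mul_one, map_one] at h; exact h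
  have h22 : Valued.v (g 2 2) ≤ 1 := by have h := hD 2 2; rw [f2, mul_one, map_one] at h; exact h
  have h12 : Valued.v (g 1 2) ≤ 1 := by have h := hD 1 2; rw [f1, f2, mul_one, map_one] at h; exact h
  have h20 : Valued.v (ϖ⁻¹ * g 2 0) ≤ 1 := by have h := hD 2 0; rw [f2, f0, mul_comm, map_one] at h; exact h
  have h10 : Valued.v (g 1 0) < 1 := by
    have h := hD 1 0
    rw [f1, f0, map_one, map_mul] at h
    rw [hlt]
    calc Valued.v (g 1 0) = Valued.v (g 1 0) * Valued.v ϖ⁻¹ * Valued.v ϖ := by rw [mul_assoc, hvinv, mul_one]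
      _ ≤ 1 * Valued.v ϖ := mul_le_mul' h le_rfl
      _ = Valued.v ϖ := one_mul _
  have h12' : Valued.v (ϖ * g 1 2) < 1 := by
    rw [hlt, map_mul]; exact mul_le_of_le_one_right' h12
  have h21 : Valued.v (ϖ⁻¹ * g 2 1) ≤ 1 := by
    have h := hN 2 1
    rw [e1, e2, mul_one] at h
    rw [map_mul]
    calc Valued.v ϖ⁻¹ * Valued.v (g 2 1) ≤ Valued.v ϖ⁻¹ * Valued.v ϖ := mul_le_mul' le_rfl h
      _ = 1 := hvinv
  -- §A′ the pure `K`-identities used below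
  have ha : Valued.v (g 0 0 - 1) ≤ 1 := by
    calc Valued.v (g 0 0 - 1) ≤ max (Valued.v (g 0 0)) (Valued.v (1 : K)) := Valuation.map_sub _ _ _
      _ ≤ 1 := max_le h00 (by rw [map_one])
  have heq1 : g 0 0 * (g 0 0 - 1) + ϖ * g 0 2 * (ϖ⁻¹ * g 2 0) - 1 * (g 0 0 - 1) = (g 0 0 - 1) ^ 2 + (ϖ * g 0 2) * (ϖ⁻¹ * g 2 0) := by ring
  have heq2 : ϖ⁻¹ * g 2 0 * (g 0 0 - 1) + g 2 2 * (ϖ⁻¹ * g 2 0) - 1 * (ϖ⁻¹ * g 2 0) = (ϖ⁻¹ * g 2 0) * ((g 0 0 - 1) + (g 2 2 - 1)) := by ring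
  -- §B the integral conjugate `A = diag(1,1,ϖ⁻¹)·g·diag(1,1,ϖ)` and its residually unipotent cube
  set A : Matrix (Fin 3) (Fin 3) K := !![g 0 0, g 0 1, ϖ * g 0 2; g 1 0, g 1 1, ϖ * g 1 2; ϖ⁻¹ * g 2 0, ϖ⁻¹ * g 2 1, g 2 2] with hAdef
  have hAconj : A = Matrix.diagonal ![(1 : K), 1, ϖ⁻¹] * g * Matrix.diagonal ![(1 : K), 1, ϖ] := by
    ext i j; fin_cases i <;> fin_cases j <;> simp [hAdef, Matrix.diagonal_mul, Matrix.mul_diagonal, mul_comm]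
    field_simp
  have hAint : IsIntMatrix A := by
    intro i j
    fin_cases i <;> fin_cases j
    · simpa [hAdef] using h00
    · simpa [hAdef] using h01
    · simpa [hAdef] using h02
    · simpa [hAdef] using h10.le
    · simpa [hAdef] using h11
    · simpa [hAdef] using h12'.le
    · simpa [hAdef] using h20
    · simpa [hAdef] using h21
    · simpa [hAdef] using h22
  have hAchar : A.charpoly = g.charpoly := by
    have hDD : Matrix.diagonal ![(1 : K), 1, ϖ] * Matrix.diagonal ![(1 : K), 1, ϖ⁻¹] = 1 := by
      rw [Matrix.diagonal_mul_diagonal, ← Matrix.diagonal_one]; congr 1; funext i; fin_cases i <;> simp [hϖ0]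
    rw [hAconj, Matrix.mul_assoc, Matrix.charpoly_mul_comm, Matrix.mul_assoc, hDD, Matrix.mul_one]
  have hcube : ∀ j l, Valued.v (((A - 1) ^ 3 : Matrix (Fin 3) (Fin 3) K) j l) < 1 := fun j l =>
    v_pow_sub_one_apply_lt_one (N := 3) hAint (fun i => by rw [hAchar]; exact hγ1 i) j l
  -- §C residues
  have memO : ∀ {x : K}, Valued.v x ≤ 1 → x ∈ 𝒪[K] := fun hx => (Valuation.mem_valuationSubring_iff _ _).2 hx
  set AO : Matrix (Fin 3) (Fin 3) 𝒪[K] := Matrix.of fun i j => (⟨A i j, memO (hAint i j)⟩ : 𝒪[K]) with hAOdef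
  have hAOval : AO.map (algebraMap 𝒪[K] K) = A := by ext i j; rfl
  set Ab : Matrix (Fin 3) (Fin 3) 𝓀[K] := AO.map (IsLocalRing.residue 𝒪[K]) with hAbdef
  have hAb3 : (Ab - 1) ^ 3 = 0 := by
    have hO : ∀ j l, IsLocalRing.residue 𝒪[K] (((AO - 1) ^ 3 : Matrix (Fin 3) (Fin 3) 𝒪[K]) j l) = 0 := by
      intro j l
      rw [residue_eq_zero_iff_v_lt_one]
      have hval : ((((AO - 1) ^ 3 : Matrix (Fin 3) (Fin 3) 𝒪[K]) j l : 𝒪[K]) : K) = ((A - 1) ^ 3 : Matrix (Fin 3) (Fin 3) K) j l := by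
        have h := congrArg (fun M : Matrix (Fin 3) (Fin 3) K => M j l) (((algebraMap 𝒪[K] K).mapMatrix).map_pow (AO - 1) 3)
        simp only [map_sub, map_one, RingHom.mapMatrix_apply, hAOval] at h
        rw [← h]; rfl
      rw [hval]; exact hcube j l
    have h := ((IsLocalRing.residue 𝒪[K]).mapMatrix).map_pow (AO - 1) 3
    simp only [map_sub, map_one, RingHom.mapMatrix_apply] at h
    rw [← hAbdef] at h
    rw [← h]
    ext j l
    rw [Matrix.map_apply, hO, Matrix.zero_apply]
  have hAb : ∀ i j, Ab i j = IsLocalRing.residue 𝒪[K] ⟨A i j, memO (hAint i j)⟩ := fun i j => rfl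
  have hAb10 : Ab 1 0 = 0 := by rw [hAb, residue_eq_zero_iff_v_lt_one]; simpa [hAdef] using h10
  have hAb12 : Ab 1 2 = 0 := by rw [hAb, residue_eq_zero_iff_v_lt_one]; simpa [hAdef] using h12'
  -- §D the two cases on `c̄ = residue (ϖ⁻¹ γ₂₀)`
  by_cases hc : Valued.v (ϖ⁻¹ * g 2 0) < 1
  · -- CASE `c̄ = 0`: the point `[1 : 0]`, `M = N₁ + 𝒪·(1∕ϖ, 0, 0) = latt diag(ϖ⁻¹, 1, ϖ)`
    have hAb20 : Ab 2 0 = 0 := by rw [hAb, residue_eq_zero_iff_v_lt_one]; simpa [hAdef] using hc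
    have hε : Valued.v (g 0 0 - 1) < 1 := by
      have h := residual_corner_eq_one_of_lower_zero hAb3 hAb10 hAb12 hAb20
      rw [hAb, ← map_one (IsLocalRing.residue 𝒪[K]), ← map_sub, residue_eq_zero_iff_v_lt_one] at h
      simpa [hAdef] using h
    refine ⟨latt (Matrix.diagonal ![(1 : K), 1, ϖ]) ⊔ Submodule.span 𝒪[K] {(![1 / ϖ, 0, 0] : Fin 3 → K)}, ?_, ?_, ?_⟩
    · exact isSelfDualLattice_N₁_sup_span_vec_of_neg hvσ hσϖ hϖ hres (le_of_eq (map_one _)) (by rw [map_zero]; exact zero_le) (Or.inl (map_one _))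
    · refine lt_of_le_of_ne le_sup_left fun heq => ?_
      have hw : (![1 / ϖ, 0, 0] : Fin 3 → K) ∈ latt (Matrix.diagonal ![(1 : K), 1, ϖ]) := by
        rw [heq]; exact Submodule.mem_sup_right (Submodule.mem_span_singleton_self _)
      rw [vec_mem_N₁_iff hϖ] at hw
      simp at hw
    · rw [mapGL_N₁_sup_span_vec_eq_iff_of_v hvσ hϖ γ hγ (le_of_eq (map_one _)) (by rw [map_zero]; exact zero_le) (Or.inl (map_one _))]
      refine ⟨1, map_one _, ?_, ?_⟩
      · simpa [← hgdef] using hε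
      · simpa [← hgdef] using hc
  · -- CASE `c̄ ≠ 0`: the point `[γ₀₀ − 1 : ϖ⁻¹γ₂₀]`
    have hc1 : Valued.v (ϖ⁻¹ * g 2 0) = 1 := le_antisymm h20 (not_lt.1 hc)
    have hAb20 : Ab 2 0 ≠ 0 := by
      rw [hAb, Ne, residue_eq_zero_iff_v_lt_one, not_lt]; simpa [hAdef] using hc1.ge
    obtain ⟨hS, hR⟩ := residual_corner_trace_det hAb3 hAb10 hAb12 hAb20
    -- the atoms of `𝒪` we compute with (`o00 o22 ob oc`) and their residues `x y b c`
    obtain ⟨o00, ho00⟩ : ∃ o : 𝒪[K], o = ⟨g 0 0, memO h00⟩ := ⟨_, rfl⟩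
    obtain ⟨o22, ho22⟩ : ∃ o : 𝒪[K], o = ⟨g 2 2, memO h22⟩ := ⟨_, rfl⟩
    obtain ⟨ob, hob⟩ : ∃ o : 𝒪[K], o = ⟨ϖ * g 0 2, memO h02⟩ := ⟨_, rfl⟩
    obtain ⟨oc, hoc⟩ : ∃ o : 𝒪[K], o = ⟨ϖ⁻¹ * g 2 0, memO h20⟩ := ⟨_, rfl⟩
    have c00 : (o00 : K) = g 0 0 := by rw [ho00]
    have c22 : (o22 : K) = g 2 2 := by rw [ho22]
    have cb : (ob : K) = ϖ * g 0 2 := by rw [hob]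
    have cc : (oc : K) = ϖ⁻¹ * g 2 0 := by rw [hoc]
    obtain ⟨rx, hrx⟩ : ∃ r : 𝓀[K], r = IsLocalRing.residue 𝒪[K] o00 := ⟨_, rfl⟩
    obtain ⟨ry, hry⟩ : ∃ r : 𝓀[K], r = IsLocalRing.residue 𝒪[K] o22 := ⟨_, rfl⟩
    obtain ⟨rb, hrb⟩ : ∃ r : 𝓀[K], r = IsLocalRing.residue 𝒪[K] ob := ⟨_, rfl⟩
    obtain ⟨rc, hrc⟩ : ∃ r : 𝓀[K], r = IsLocalRing.residue 𝒪[K] oc := ⟨_, rfl⟩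
    have hx00 : Ab 0 0 = rx := by rw [hrx, ho00]; rfl
    have hx22 : Ab 2 2 = ry := by rw [hry, ho22]; rfl
    have hx02 : Ab 0 2 = rb := by rw [hrb, hob]; rfl
    have hx20 : Ab 2 0 = rc := by rw [hrc, hoc]; rfl
    rw [hx00, hx22] at hS
    rw [hx00, hx22, hx02, hx20] at hR
    -- trace and determinant at the `K` level
    have hSK : Valued.v ((g 0 0 - 1) + (g 2 2 - 1)) < 1 := by
      have h : IsLocalRing.residue 𝒪[K] (o00 - 1 + (o22 - 1)) = 0 := by rw [map_add, map_sub, map_sub, map_one, ← hrx, ← hry]; exact hS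
      rw [residue_eq_zero_iff_v_lt_one] at h
      have hval : ((o00 - 1 + (o22 - 1) : 𝒪[K]) : K) = (g 0 0 - 1) + (g 2 2 - 1) := by push_cast; rw [c00, c22]
      rwa [hval] at h
    -- the residual identity we lift back to `K`: `ε² + bc ∈ 𝔪` (fixed-point test)
    have hfixK : Valued.v ((g 0 0 - 1) ^ 2 + (ϖ * g 0 2) * (ϖ⁻¹ * g 2 0)) < 1 := by
      have h : IsLocalRing.residue 𝒪[K] ((o00 - 1) ^ 2 + ob * oc) = 0 := by
        rw [map_add, map_pow, map_mul, map_sub, map_one, ← hrx, ← hrb, ← hrc]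
        linear_combination (rx - 1) * hS - hR
      rw [residue_eq_zero_iff_v_lt_one] at h
      have hval : (((o00 - 1) ^ 2 + ob * oc : 𝒪[K]) : K) = (g 0 0 - 1) ^ 2 + (ϖ * g 0 2) * (ϖ⁻¹ * g 2 0) := by push_cast; rw [c00, cb, cc]
      rwa [hval] at h
    -- the neighbour `M = N₁ + 𝒪·w(γ₀₀ − 1, ϖ⁻¹γ₂₀)` — self-dual like every primitive neighbour at a ramified place
    refine ⟨latt (Matrix.diagonal ![(1 : K), 1, ϖ]) ⊔ Submodule.span 𝒪[K] {(![(g 0 0 - 1) / ϖ, 0, ϖ⁻¹ * g 2 0] : Fin 3 → K)}, ?_, ?_, ?_⟩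
    · exact isSelfDualLattice_N₁_sup_span_vec_of_neg hvσ hσϖ hϖ hres ha h20 (Or.inr hc1)
    · refine lt_of_le_of_ne le_sup_left fun heq => ?_
      have hw : (![(g 0 0 - 1) / ϖ, 0, ϖ⁻¹ * g 2 0] : Fin 3 → K) ∈ latt (Matrix.diagonal ![(1 : K), 1, ϖ]) := by
        rw [heq]; exact Submodule.mem_sup_right (Submodule.mem_span_singleton_self _)
      rw [vec_mem_N₁_iff hϖ] at hw
      exact absurd hw.2 (not_lt.2 hc1.ge)
    · rw [mapGL_N₁_sup_span_vec_eq_iff_of_v hvσ hϖ γ hγ ha h20 (Or.inr hc1)]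
      refine ⟨1, map_one _, ?_, ?_⟩
      · have h := hfixK
        rw [← heq1] at h; exact h
      · have h : Valued.v ((ϖ⁻¹ * g 2 0) * ((g 0 0 - 1) + (g 2 2 - 1))) < 1 := by
          rw [map_mul]; exact lt_of_le_of_lt (mul_le_of_le_one_left' h20) hSK
        rw [← heq2] at h; exact h

/-! ## §2 The head: any type-two vertex at a tamely ramified place -/

/-- **S-a3-ram: AT A TAMELY RAMIFIED PLACE A RESIDUALLY UNIPOTENT ELEMENT OF A TYPE-TWO VERTEX STABILISER FIXES A SELF-DUAL NEIGHBOUR** (`N = 3`; `σ` valuation-preserving,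
`σϖ = −ϖ`, `σ` trivial on the residue field; `htr₂` = «`U(σ, J₀)` acts transitively on type-two vertices», carried as a hypothesis exactly as ★ S-a3 carries it): if
`δ ∈ U(σ, J₀)` has `charpoly δ ≡ (X − 1)³ mod 𝔪` coefficientwise and fixes a type-two vertex `N`, then `δ` fixes a SELF-DUAL vertex `M` with `N < M`.  Transport:
`N = u·N₁`, `δ′ := u⁻¹δu` fixes `N₁`, has the same characteristic polynomial, and `M = u·M′` (§1). [cite: BruhatTits1972, §10] [cite: Tits1979, §3.5] [cite: Serre1980Trees, I.6.1 and II.1.1] -/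
theorem exists_isSelfDualLattice_gt_mapGL_eq_of_charpoly_of_neg (hvσ : ∀ a, Valued.v (σ a) = Valued.v a) (hσϖ : σ ϖ = -ϖ)
    (hϖ : Valued.v ϖ = WithZero.exp (-1 : ℤ)) (hres : ∀ x : K, Valued.v x ≤ 1 → Valued.v (σ x - x) < 1)
    (htr₂ : ∀ M : Submodule 𝒪[K] (Fin 3 → K), IsVertexLattice σ ϖ ((StdForm.antidiagonal 3).over K) 2 M →
      ∃ u : unitaryGroupOfForm σ ((StdForm.antidiagonal 3).over K), M = mapGL (u : GL (Fin 3) K) (latt (Matrix.diagonal ![(1 : K), 1, ϖ])))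
    {δ : GL (Fin 3) K} (hδ : δ ∈ unitaryGroupOfForm σ ((StdForm.antidiagonal 3).over K))
    (hδ1 : ∀ i, Valued.v ((δ : Matrix (Fin 3) (Fin 3) K).charpoly.coeff i - (1 : Matrix (Fin 3) (Fin 3) K).charpoly.coeff i) < 1)
    {N : Submodule 𝒪[K] (Fin 3 → K)} (hN : IsVertexLattice σ ϖ ((StdForm.antidiagonal 3).over K) 2 N) (hδN : mapGL δ N = N) :
    ∃ M : Submodule 𝒪[K] (Fin 3 → K), IsSelfDualLattice σ ϖ ((StdForm.antidiagonal 3).over K) M ∧ N < M ∧ mapGL δ M = M := by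
  obtain ⟨u, rfl⟩ := htr₂ N hN
  -- `δ′ := u⁻¹ δ u ∈ U(σ, J₀)` fixes `N₁` and has the same characteristic polynomial
  let γ : unitaryGroupOfForm σ ((StdForm.antidiagonal 3).over K) := u⁻¹ * ⟨δ, hδ⟩ * u
  have hγcoe : (γ : GL (Fin 3) K) = (u : GL (Fin 3) K)⁻¹ * δ * (u : GL (Fin 3) K) := rfl
  have hγN₁ : mapGL (γ : GL (Fin 3) K) (latt (Matrix.diagonal ![(1 : K), 1, ϖ])) = latt (Matrix.diagonal ![(1 : K), 1, ϖ]) := by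
    have h := congrArg (mapGL ((u : GL (Fin 3) K)⁻¹)) hδN
    rw [← mapGL_mul, ← mapGL_mul, ← mapGL_mul, inv_mul_cancel, mapGL_one] at h
    rw [hγcoe]; exact h
  have hγchar : (((γ : GL (Fin 3) K)) : Matrix (Fin 3) (Fin 3) K).charpoly = (δ : Matrix (Fin 3) (Fin 3) K).charpoly := by
    rw [hγcoe, Units.val_mul, Units.val_mul, Matrix.mul_assoc, Matrix.charpoly_mul_comm, Matrix.mul_assoc, ← Units.val_mul, mul_inv_cancel, Units.val_one, Matrix.mul_one]
  obtain ⟨M', hM', hlt, hfix⟩ := exists_isSelfDualLattice_gt_N₁_mapGL_eq_of_neg hvσ hσϖ hϖ hres γ hγN₁ (fun i => by rw [hγchar]; exact hδ1 i)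
  refine ⟨mapGL (u : GL (Fin 3) K) M', isVertexLattice_mapGL σ ϖ _ _ u.2 hM', (mapGL_lt_mapGL_iff _ _ _).2 hlt, ?_⟩
  -- `δ·(u·M′) = u·(δ′·M′) = u·M′`
  have hδu : δ * (u : GL (Fin 3) K) = (u : GL (Fin 3) K) * (γ : GL (Fin 3) K) := by rw [hγcoe, ← mul_assoc, ← mul_assoc, mul_inv_cancel, one_mul]
  rw [← mapGL_mul, hδu, mapGL_mul, hfix]

end Ramified

end Literature.NumberTheory.Automorphic.UnitaryLatticeTree

end
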